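import Summits.CriticalPhenomena.CardyFormulaZ2.Theorems.CardyTensorRGPolyominoGaussianLawReduction
import Literature.Probability.RandomPlanarGeometry.ConformalRectangleProofs

/-!
# The dyadic cut of the crux `PolyominoGaussianLaw` is lossless
# (stmt-CriticalPhenomena-14337, route `CardyTensorRG`, line `registered`, skeleton v6)

The line's skeleton reduces the crux `CardyTensorRG.PolyominoGaussianLaw` to its two registered
pure-dyadic cores (`stub_reductionToDyadic`, landed):

* (E) dyadic LimitExists — for every polyomino representation `(δ₀, s)` with lattice marks of a
  conformal rectangle `R`, the bond-`ℤ²` crossing probabilities at meshes `δ₀ · 2^(−k)` converge;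
* (I) dyadic identification — ONE `a ∈ (0,1)` such that every such dyadic limit, for every
  uniformizing datum `(φ, x)`, equals `I_a(crossRatio x)` (normalised symmetric incomplete beta law).

This file proves the CONVERSE implications, so that the cut wastes no strength and the crux is
in-tree EQUIVALENT to `(E) ∧ (I)` (`stub_dyadicCutLossless`, registered helper stub), and also to the single
"dyadic law" `(D)`: ONE `a ∈ (0,1)` such that along every dyadic orbit of every polyomino
representation the crossing probabilities converge to `I_a(crossRatio x)` for every uniformizing datum
(`stub_dyadicLawIff`, registered helper stub) — the natural typed conclusion for the glue item
RGToPolyominoLaw (stmt-CriticalPhenomena-14645). Inputs: the crux restricted along the sequence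
`δ₀ · 2^(−k) → 0⁺` (`tendsto_dyadicMesh`), uniqueness of limits in `ℝ`, and — for (E), whose
statement carries no uniformizing datum — the existence of uniformizing data
(`MarkedDomain.exists_isUniformizing_holds`, Riemann mapping + Carathéodory, a theorem of the tree).
-/

open Filter Topology Set

namespace Summit.CriticalPhenomena.CardyFormulaZ2.Cruxes.PolyominoGaussianLaw.Birth

/-- The dyadic mesh sequence `δ₀ · 2^(−k)` tends to `0` from the right. [folklore] -/
theorem tendsto_dyadicMesh {δ₀ : ℝ} (hδ₀ : 0 < δ₀) :
    Tendsto (fun k : ℕ => δ₀ / 2 ^ k) atTop (𝓝[>] (0 : ℝ)) := by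
  rw [tendsto_nhdsWithin_iff]
  refine ⟨?_, Eventually.of_forall fun k => div_pos hδ₀ (pow_pos two_pos k)⟩
  have h : Tendsto (fun k : ℕ => δ₀ * ((1 : ℝ) / 2) ^ k) atTop (𝓝 (δ₀ * 0)) :=
    (tendsto_pow_atTop_nhds_zero_of_lt_one (by norm_num) (by norm_num)).const_mul δ₀
  rw [mul_zero] at h
  refine h.congr' (Eventually.of_forall fun k => ?_)
  show δ₀ * ((1 : ℝ) / 2) ^ k = δ₀ / 2 ^ k
  rw [one_div, inv_pow, div_eq_mul_inv]

/-- **Crux ⇒ dyadic law (D)**: restricting the one-sided limit `δ → 0⁺` of the crux along the dyadic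
orbit `δ₀ · 2^(−k)` of any polyomino representation gives convergence to `I_a(crossRatio x)` for every
uniformizing datum. [folklore] -/
theorem dyadicLaw_of_polyominoGaussianLaw
    (h : Summit.CriticalPhenomena.CardyFormulaZ2.Theses.CardyTensorRG.PolyominoGaussianLaw) :
    ∃ a : ℝ, a ∈ Set.Ioo (0 : ℝ) 1 ∧
      ∀ R : Literature.Probability.RandomPlanarGeometry.ConformalRectangle, ∀ δ₀ : ℝ, 0 < δ₀ →
      (∃ s : Finset (ℤ × ℤ), R.carrier = interior (⋃ p ∈ s, {z : ℂ | δ₀ * (p.1 : ℝ) ≤ z.re ∧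
        z.re ≤ δ₀ * ((p.1 : ℝ) + 1) ∧ δ₀ * (p.2 : ℝ) ≤ z.im ∧ z.im ≤ δ₀ * ((p.2 : ℝ) + 1)})) →
      (∀ i, ∃ m n : ℤ, R.pt i = (δ₀ : ℂ) * ((m : ℂ) + (n : ℂ) * Complex.I)) →
      ∀ (φ : Literature.Probability.RandomPlanarGeometry.ConformalEquiv UpperHalfPlane.upperHalfPlaneSet R.carrier)
        (x : Fin 4 → ℝ), R.IsUniformizing φ x →
      Filter.Tendsto
        (fun k : ℕ => Literature.Probability.Percolation.bondDomainCrossingProb R (δ₀ / 2 ^ k))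
        Filter.atTop (nhds (intervalIntegral (fun s : ℝ => (s * (1 - s)) ^ (-a)) 0
              (Literature.Probability.RandomPlanarGeometry.crossRatio x) MeasureTheory.volume /
            intervalIntegral (fun s : ℝ => (s * (1 - s)) ^ (-a)) 0 1 MeasureTheory.volume)) := by
  obtain ⟨a, ha, hlaw⟩ := h
  refine ⟨a, ha, ?_⟩
  intro R δ₀ hδ₀ hs hmarks φ x hφ
  exact (hlaw R ⟨δ₀, hδ₀, hs, hmarks⟩ φ x hφ).comp (tendsto_dyadicMesh hδ₀)

/-- **Crux ⇒ dyadic identification (I)** (the registered stub `stub_dyadicLimitIsBetaLaw` follows from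
the crux): a dyadic orbit limit `L` and the crux's limit `I_a(crossRatio x)` along the same orbit
coincide by uniqueness of limits in `ℝ`. [folklore] -/
theorem dyadicLimitIsBetaLaw_of_polyominoGaussianLaw
    (h : Summit.CriticalPhenomena.CardyFormulaZ2.Theses.CardyTensorRG.PolyominoGaussianLaw) :
    ∃ a : ℝ, a ∈ Set.Ioo (0 : ℝ) 1 ∧
      ∀ R : Literature.Probability.RandomPlanarGeometry.ConformalRectangle, ∀ δ₀ : ℝ, 0 < δ₀ →
      (∃ s : Finset (ℤ × ℤ), R.carrier = interior (⋃ p ∈ s, {z : ℂ | δ₀ * (p.1 : ℝ) ≤ z.re ∧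
        z.re ≤ δ₀ * ((p.1 : ℝ) + 1) ∧ δ₀ * (p.2 : ℝ) ≤ z.im ∧ z.im ≤ δ₀ * ((p.2 : ℝ) + 1)})) →
      (∀ i, ∃ m n : ℤ, R.pt i = (δ₀ : ℂ) * ((m : ℂ) + (n : ℂ) * Complex.I)) →
      ∀ (φ : Literature.Probability.RandomPlanarGeometry.ConformalEquiv UpperHalfPlane.upperHalfPlaneSet R.carrier)
        (x : Fin 4 → ℝ), R.IsUniformizing φ x →
      ∀ L : ℝ, Filter.Tendsto
        (fun k : ℕ => Literature.Probability.Percolation.bondDomainCrossingProb R (δ₀ / 2 ^ k))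
        Filter.atTop (nhds L) →
        L = intervalIntegral (fun s : ℝ => (s * (1 - s)) ^ (-a)) 0
              (Literature.Probability.RandomPlanarGeometry.crossRatio x) MeasureTheory.volume /
            intervalIntegral (fun s : ℝ => (s * (1 - s)) ^ (-a)) 0 1 MeasureTheory.volume := by
  obtain ⟨a, ha, hlaw⟩ := dyadicLaw_of_polyominoGaussianLaw h
  refine ⟨a, ha, ?_⟩
  intro R δ₀ hδ₀ hs hmarks φ x hφ L hL
  exact tendsto_nhds_unique hL (hlaw R δ₀ hδ₀ hs hmarks φ x hφ)

/-- **Crux ⇒ dyadic LimitExists (E)** (the registered stub `stub_dyadicLimitExists` follows from the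
crux): a polyomino conformal rectangle has SOME uniformizing datum
(`MarkedDomain.exists_isUniformizing_holds`), along which the crux gives the limit `I_a(crossRatio x)`.
[folklore] -/
theorem dyadicLimitExists_of_polyominoGaussianLaw
    (h : Summit.CriticalPhenomena.CardyFormulaZ2.Theses.CardyTensorRG.PolyominoGaussianLaw) :
    ∀ R : Literature.Probability.RandomPlanarGeometry.ConformalRectangle, ∀ δ₀ : ℝ, 0 < δ₀ →
      (∃ s : Finset (ℤ × ℤ), R.carrier = interior (⋃ p ∈ s, {z : ℂ | δ₀ * (p.1 : ℝ) ≤ z.re ∧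
        z.re ≤ δ₀ * ((p.1 : ℝ) + 1) ∧ δ₀ * (p.2 : ℝ) ≤ z.im ∧ z.im ≤ δ₀ * ((p.2 : ℝ) + 1)})) →
      (∀ i, ∃ m n : ℤ, R.pt i = (δ₀ : ℂ) * ((m : ℂ) + (n : ℂ) * Complex.I)) →
      ∃ L : ℝ, Filter.Tendsto
        (fun k : ℕ => Literature.Probability.Percolation.bondDomainCrossingProb R (δ₀ / 2 ^ k))
        Filter.atTop (nhds L) := by
  obtain ⟨a, -, hlaw⟩ := dyadicLaw_of_polyominoGaussianLaw h
  intro R δ₀ hδ₀ hs hmarks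
  obtain ⟨φ, x, hφ⟩ :=
    Literature.Probability.RandomPlanarGeometry.MarkedDomain.exists_isUniformizing_holds R
  exact ⟨_, hlaw R δ₀ hδ₀ hs hmarks φ x hφ⟩

/-- **The dyadic cut is lossless**: the crux `PolyominoGaussianLaw` is EQUIVALENT to the conjunction of
its two registered pure-dyadic cores, dyadic LimitExists (E) and dyadic identification (I)
(`←` is the landed reduction `stub_reductionToDyadic`; `→` is the two theorems above). [folklore] -/
theorem stub_dyadicCutLossless :
    Summit.CriticalPhenomena.CardyFormulaZ2.Theses.CardyTensorRG.PolyominoGaussianLaw ↔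
    ((∀ R : Literature.Probability.RandomPlanarGeometry.ConformalRectangle, ∀ δ₀ : ℝ, 0 < δ₀ →
      (∃ s : Finset (ℤ × ℤ), R.carrier = interior (⋃ p ∈ s, {z : ℂ | δ₀ * (p.1 : ℝ) ≤ z.re ∧
        z.re ≤ δ₀ * ((p.1 : ℝ) + 1) ∧ δ₀ * (p.2 : ℝ) ≤ z.im ∧ z.im ≤ δ₀ * ((p.2 : ℝ) + 1)})) →
      (∀ i, ∃ m n : ℤ, R.pt i = (δ₀ : ℂ) * ((m : ℂ) + (n : ℂ) * Complex.I)) →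
      ∃ L : ℝ, Filter.Tendsto
        (fun k : ℕ => Literature.Probability.Percolation.bondDomainCrossingProb R (δ₀ / 2 ^ k))
        Filter.atTop (nhds L)) ∧
    (∃ a : ℝ, a ∈ Set.Ioo (0 : ℝ) 1 ∧
      ∀ R : Literature.Probability.RandomPlanarGeometry.ConformalRectangle, ∀ δ₀ : ℝ, 0 < δ₀ →
      (∃ s : Finset (ℤ × ℤ), R.carrier = interior (⋃ p ∈ s, {z : ℂ | δ₀ * (p.1 : ℝ) ≤ z.re ∧
        z.re ≤ δ₀ * ((p.1 : ℝ) + 1) ∧ δ₀ * (p.2 : ℝ) ≤ z.im ∧ z.im ≤ δ₀ * ((p.2 : ℝ) + 1)})) →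
      (∀ i, ∃ m n : ℤ, R.pt i = (δ₀ : ℂ) * ((m : ℂ) + (n : ℂ) * Complex.I)) →
      ∀ (φ : Literature.Probability.RandomPlanarGeometry.ConformalEquiv UpperHalfPlane.upperHalfPlaneSet R.carrier)
        (x : Fin 4 → ℝ), R.IsUniformizing φ x →
      ∀ L : ℝ, Filter.Tendsto
        (fun k : ℕ => Literature.Probability.Percolation.bondDomainCrossingProb R (δ₀ / 2 ^ k))
        Filter.atTop (nhds L) →
        L = intervalIntegral (fun s : ℝ => (s * (1 - s)) ^ (-a)) 0
              (Literature.Probability.RandomPlanarGeometry.crossRatio x) MeasureTheory.volume /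
            intervalIntegral (fun s : ℝ => (s * (1 - s)) ^ (-a)) 0 1 MeasureTheory.volume)) :=
  ⟨fun h => ⟨dyadicLimitExists_of_polyominoGaussianLaw h, dyadicLimitIsBetaLaw_of_polyominoGaussianLaw h⟩,
    fun h => stub_reductionToDyadic h.1 h.2⟩

/-- **Crux ⇔ dyadic law (D)**: `PolyominoGaussianLaw` is EQUIVALENT to the single dyadic statement —
ONE `a ∈ (0,1)` such that along the dyadic orbit `δ₀ · 2^(−k)` of every polyomino representation with
lattice marks the bond-`ℤ²` crossing probabilities converge to `I_a(crossRatio x)` for every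
uniformizing datum `(φ, x)`. (`→`: restriction along the orbit; `←`: (D) gives (E) via
`exists_isUniformizing_holds` and (I) via uniqueness of limits, then `stub_reductionToDyadic`.) This is
the conclusion the glue item RGToPolyominoLaw (stmt-14645) has to deliver for the crux. [folklore] -/
theorem stub_dyadicLawIff :
    Summit.CriticalPhenomena.CardyFormulaZ2.Theses.CardyTensorRG.PolyominoGaussianLaw ↔
    ∃ a : ℝ, a ∈ Set.Ioo (0 : ℝ) 1 ∧
      ∀ R : Literature.Probability.RandomPlanarGeometry.ConformalRectangle, ∀ δ₀ : ℝ, 0 < δ₀ →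
      (∃ s : Finset (ℤ × ℤ), R.carrier = interior (⋃ p ∈ s, {z : ℂ | δ₀ * (p.1 : ℝ) ≤ z.re ∧
        z.re ≤ δ₀ * ((p.1 : ℝ) + 1) ∧ δ₀ * (p.2 : ℝ) ≤ z.im ∧ z.im ≤ δ₀ * ((p.2 : ℝ) + 1)})) →
      (∀ i, ∃ m n : ℤ, R.pt i = (δ₀ : ℂ) * ((m : ℂ) + (n : ℂ) * Complex.I)) →
      ∀ (φ : Literature.Probability.RandomPlanarGeometry.ConformalEquiv UpperHalfPlane.upperHalfPlaneSet R.carrier)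
        (x : Fin 4 → ℝ), R.IsUniformizing φ x →
      Filter.Tendsto
        (fun k : ℕ => Literature.Probability.Percolation.bondDomainCrossingProb R (δ₀ / 2 ^ k))
        Filter.atTop (nhds (intervalIntegral (fun s : ℝ => (s * (1 - s)) ^ (-a)) 0
              (Literature.Probability.RandomPlanarGeometry.crossRatio x) MeasureTheory.volume /
            intervalIntegral (fun s : ℝ => (s * (1 - s)) ^ (-a)) 0 1 MeasureTheory.volume)) := by
  refine ⟨dyadicLaw_of_polyominoGaussianLaw, fun h => ?_⟩
  obtain ⟨a, ha, hlaw⟩ := h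
  refine stub_reductionToDyadic ?_ ⟨a, ha, ?_⟩
  · intro R δ₀ hδ₀ hs hmarks
    obtain ⟨φ, x, hφ⟩ :=
      Literature.Probability.RandomPlanarGeometry.MarkedDomain.exists_isUniformizing_holds R
    exact ⟨_, hlaw R δ₀ hδ₀ hs hmarks φ x hφ⟩
  · intro R δ₀ hδ₀ hs hmarks φ x hφ L hL
    exact tendsto_nhds_unique hL (hlaw R δ₀ hδ₀ hs hmarks φ x hφ)

end Summit.CriticalPhenomena.CardyFormulaZ2.Cruxes.PolyominoGaussianLaw.Birth
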